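import Summits.Schanuel.Schanuel.Theorems.RootDecomp1BMovingZeroFree04

/-!
# RootDecomp1BMovingZeroFree — lens 4, generation 42 «LEVEL-e SLOT BY PROOF» (RULE E-R21 (c) + B-R26 (a″); VERDICT L2187: THEOREM ×1 (B-g42)): the (1 | ρ) moving-zero storey HYPOTHESIS-FREE and one exponential order lower — `∀ ρ, LiouvilleOrder 7 ρ → 4 ≤ polarDeg (1, ρ)` and every (1|ρ) cell / member / 1K-link instance of FactDischarge01 + MovingZero02 §4 UNCONDITIONAL (record: order 8 mod hX) — the slot `ExpOneAlgApprox C` (an approximation measure for e with the degree binder n ≤ Y) filled BY PROOF from the Literature theorem NW96 Thm 4 (2), new separating member T₈ = towerNumber 8 — continuation (RootDecomp1BMovingZeroFree05): §5 the record as an instance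

(lens-4 g42 HOME kernel MovingZeroFree.lean 1a475554…, 622 l, imports tree RootDecomp1BFactDischarge01 + Literature ExpOneTranscendenceMeasureProofs; CLAIM L2168, ACK/RULING/CHECKLIST B-g42 L2169, NODE L2183 / REQUEST L2184 / RESULT L2185, writer re-check L2186, critic VERDICT L2187 (CLEARED — THEOREM ×1 (B-g42); RULE B-R28; PORT GO 01–05 along K's § boundaries, `--supports stmt-Schanuel-24622`); port by census-1 gen 18 as `RootDecomp1BMovingZeroFree01`–`05`: 01 = §1 the slot `ExpOneAlgApprox` + its two suppliers (record hX, and BY PROOF from NW96 Thm 4(2)); 02 = §2 the budget and the engine one order lower (slot + `LiouvilleOrder 7` + moving zero ⟹ t ≥ 4); 03 = §3 the cells HYPOTHESIS-FREE; 04 = §4 members binder-free + the separating member `T₈ = towerNumber 8`; 05 = §5 the record recovered as an instance.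
PORT EDITS: the slot def's docstring tagged «[slot] definition with parameter; suppliers …» per the verdict (census convention); no `set_option` in K; three tree-twin helpers made `private` after the dedup bounce of 01 (p830609: `irreducible_map_rat_of_irreducible` ≡ Literature NW1996, `nesterenkoWaldschmidt1996_thm_4_2_inScope` ≡ `NesterenkoWaldschmidt1996_thm_4_2_holds`, `one_lt_log_sixteen` ≡ Literature Waldschmidt1978) with per-part private copies; likewise `log_le_log_add_div_sub_one` (≡ Literature Fourier SlitStrip, bounce p830636) and `one_le_log_add_one`; and `four_le_polarDeg_one_ultra` (§3 read-back ≡ tree `RootDecomp1BFactDischarge.four_le_polarDeg_one_ultra`, bounce p830998); and the §5 read-back `four_le_polarDeg_of_movingZero'` (≡ tree `RootDecomp1BMovingZero.four_le_polarDeg_of_movingZero`, bounce p831586); statements and proofs verbatim. `--supports stmt-Schanuel-24622`; no census credit carried; rung 0 — nothing here proves Schanuel.)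
-/

noncomputable section

open Complex Polynomial

namespace Summit.Schanuel.Schanuel.Theorems.RootDecomp1BMovingZeroFree

open Summit.Schanuel.Schanuel.Theorems.RootDecomp1KHyper (LWMeasure)
open Summit.Schanuel.Schanuel.Theorems.RootDecomp1KHyper.HyperCell (log_sixteen_lt_three HyperLiouville lambdaH
  hyperLiouville_lambdaH ExplicitRatExpApprox C₀rat)
open Summit.Schanuel.Schanuel.Theorems.RootDecomp1KGeneric (LiouvilleOrder)
open Summit.Schanuel.Schanuel.Theorems.RootDecomp1KFiniteOrderCell (towerNumber liouvilleOrder_towerNumber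
  not_hyperLiouville_towerNumber towerNumber_sub_rat_lower liouville_towerNumber not_liouvilleOrder_towerNumber)
open Summit.Schanuel.Schanuel.Theorems.RootDecomp1BFedFlagCore (polarDeg polarField)
open Summit.Schanuel.Schanuel.Theorems.RootDecomp1BDefectFloorDefs (SharpRelativeLindemannAt TameDefectZeroAt
  WildSharpDefectZeroAt WildSharpDefectZeroInitAt)
open Summit.Schanuel.Schanuel.Theorems.RootDecomp1BRadicalDescent (UltraLiouville linearIndependent_one_of_irrational)
open Summit.Schanuel.Schanuel.Theorems.RootDecomp1BMovingZero (triple MovingZeroApprox algebraicIndependent_triple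
  isAlgebraic_pair_of_lt_four mem_polarField_one mem_polarField_swap factor_le four_le_polarDeg_of_movingZero
  liouvilleOrder_rhoT not_hyperLiouville_rhoT not_ultraLiouville_rhoT)
open Summit.Schanuel.Schanuel.Theorems.RootDecomp1BFactDischarge (lwMeasure_holds movingZeroApprox_holds)
open Literature.NumberTheory.Transcendental (NesterenkoWaldschmidt1996_thm_4_2 NesterenkoWaldschmidt1996_thm_4_2_holds)
open Literature.NumberTheory.Transcendental.NW1996 (approx_measure_exp_one)

/-! ## §5  The record recovered as an instance (one order lower, still mod `hX`) -/

/-- The record's endgame is the instance `Cₑ = 4 · C₀rat 1` of the engine — and gains one order: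
mod `hLW`, `hX` and the piece, exponential order `7` already suffices. -/
theorem four_le_polarDeg_of_movingZero_seven (hLW : LWMeasure) (hX : ExplicitRatExpApprox) {ρ : ℝ}
    (hρ : LiouvilleOrder 7 ρ) (hMZ : MovingZeroApprox ρ) {m : ℕ} {r : Fin m → ℝ}
    (hρr : (ρ : ℂ) ∈ polarField r) (he : cexp 1 ∈ polarField r) (hei : cexp Complex.I ∈ polarField r)
    (heρ : cexp ρ ∈ polarField r) (heρi : cexp (ρ * Complex.I) ∈ polarField r) :
    ((2 + 2 : ℕ) : Cardinal) ≤ polarDeg r :=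
  four_le_polarDeg_of_slot hLW (by have := C₀rat_nonneg 1; positivity) (expOneAlgApprox_of_explicitRatExpApprox hX)
    hρ hMZ hρr he hei heρ heρi

/-- … and the record statement itself (order 8, mod `hLW`, `hX`, piece) is a corollary of the new engine. -/
private theorem four_le_polarDeg_of_movingZero' (hLW : LWMeasure) (hX : ExplicitRatExpApprox) {ρ : ℝ}
    (hρ : LiouvilleOrder 8 ρ) (hMZ : MovingZeroApprox ρ) {m : ℕ} {r : Fin m → ℝ}
    (hρr : (ρ : ℂ) ∈ polarField r) (he : cexp 1 ∈ polarField r) (hei : cexp Complex.I ∈ polarField r)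
    (heρ : cexp ρ ∈ polarField r) (heρi : cexp (ρ * Complex.I) ∈ polarField r) :
    ((2 + 2 : ℕ) : Cardinal) ≤ polarDeg r :=
  four_le_polarDeg_of_movingZero_seven hLW hX (hρ.mono (by norm_num)) hMZ hρr he hei heρ heρi

/-- SUMMARY of the storey (conjunction, for the census): the general-field cell at order 7, the `(1, ρ)` cell at
order 7, the record name at order 8, the hyper class, and the three named members — all UNCONDITIONAL. -/
theorem storey_two_free :
    (∀ ρ : ℝ, LiouvilleOrder 7 ρ → ((2 + 2 : ℕ) : Cardinal) ≤ polarDeg ![(1 : ℝ), ρ]) ∧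
    (∀ ρ : ℝ, LiouvilleOrder 8 ρ → ((2 + 2 : ℕ) : Cardinal) ≤ polarDeg ![(1 : ℝ), ρ]) ∧
    (∀ ρ : ℝ, HyperLiouville ρ → ((2 + 2 : ℕ) : Cardinal) ≤ polarDeg ![(1 : ℝ), ρ]) ∧
    ((2 + 2 : ℕ) : Cardinal) ≤ polarDeg ![(1 : ℝ), towerNumber 8] ∧
    ((2 + 2 : ℕ) : Cardinal) ≤ polarDeg ![(1 : ℝ), towerNumber 9] ∧
    ((2 + 2 : ℕ) : Cardinal) ≤ polarDeg ![(1 : ℝ), lambdaH] :=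
  ⟨fun _ h => four_le_polarDeg_one_of_liouvilleOrder_seven h, fun _ h => four_le_polarDeg_one_of_liouvilleOrder_eight h,
    fun _ h => four_le_polarDeg_one_hyper h, four_le_polarDeg_one_towerNumber_eight, four_le_polarDeg_one_rhoT,
    four_le_polarDeg_one_lambdaH⟩

end Summit.Schanuel.Schanuel.Theorems.RootDecomp1BMovingZeroFree

end
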